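import Summits.Langlands.Langlands.Statement
import Literature.NumberTheory.Automorphic.RamakrishnanTensorProductGL2
import HarnessLib

/-!
# Line `RankinSelbergGL3GL3` — ON-PATH FILE (forward generator G4 ladder-down, generation 25)
# top crux `IrreducibilityBySelfDuality.ReciprocityUpToIrreducibility` (stmt-Langlands-14328)

`Langlands → RankinSelbergGaloisToAutomorphic m n` for every `m, n ≥ 1` (restriction of clause (B) at rank `mn` to
the `Rec` the summit provides: the family's de Rham clause is against `fontainePstAdicCompletion = Rec.pst` by
`rfl`, a.e. unramifiedness is read off the Satake-match hypothesis, cuspidal ⇒ automorphic, `Corresponds` ⊃ a.e.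
Satake), and the `@[aesop safe apply]` instance `RankinSelbergGL3GL3_of_Langlands` used by the kernel's on-path
test.  No `sorry`.
-/

noncomputable section

set_option linter.dupNamespace false

open scoped MatrixGroups Matrix NumberField Classical Polynomial
open Filter IsDedekindDomain Field Polynomial
open Literature.NumberTheory.Automorphic Literature.NumberTheory.GaloisRepresentations
open Literature.NumberTheory.PAdicHodge
open Summit.Langlands

namespace Summit.Langlands.Langlands.Cruxes.ReciprocityUpToIrreducibility.RankinSelbergGL3GL3

/-! ## 2. The graded family (dial = the pair of factor ranks `(m, n)`, target rank `m * n`) and the rung `(3,3)` -/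

/-- **The rung family** `RankinSelbergGaloisToAutomorphic m n`: clause (B) of the summit (Galois ⇒ automorphic)
over EVERY number field `F`, at EVERY `ℓ` and `ι : ℚ̄_ℓ ≃ ℂ`, in the a.e.-Satake form, for irreducible
`ρ : Γ_F → GL_{mn}(ℚ̄_ℓ)` de Rham above `ℓ` (pinned Fontaine datum `fontainePstAdicCompletion`) whose Frobenius
characteristic polynomials are, at all but finitely many places, the `ι`-Satake polynomials of `α_v ⊗ β_v` for the
Satake parameters `α_v`, `β_v` of a pair of CUSPIDAL `π₁` on `GL_m(𝔸_F)`, `π₂` on `GL_n(𝔸_F)` — the unramified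
shadow of "`ρ ≅ ρ_{π₁} ⊗ ρ_{π₂}`", stated without assuming that `π₁`, `π₂` have Galois representations.
Conclusion: an AUTOMORPHIC `P` on `GL_{mn}(𝔸_F)` (Borel–Jacquet datum, not asserted cuspidal) with
`SatakeFrobCompatibleAt ι P ρ v` for almost all `v`.  Implied by the summit and by E for every `m, n ≥ 1`
(`…_of_langlands`, `…_of_top`); implied by `WeakTensorProductFunctoriality m n`
(`of_weakTensorProductFunctoriality`), hence PROVED at `(2,2)` modulo the in-tree named fact and at `(2,3)` modulo
Kim–Shahidi Thm A; OPEN at `(3,3)` (`GL₃ × GL₃ → GL₉`). -/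
def RankinSelbergGaloisToAutomorphic (m n : ℕ) : Prop :=
  ∀ (F : Type) [Field F] [NumberField F]
    (hm : Literature.NumberTheory.Automorphic.isCompact_glFiniteIntegralLevel m F)
    (hn : Literature.NumberTheory.Automorphic.isCompact_glFiniteIntegralLevel n F)
    (π₁ : Literature.NumberTheory.Automorphic.CuspidalAutomorphicRepData m F hm)
    (π₂ : Literature.NumberTheory.Automorphic.CuspidalAutomorphicRepData n F hn)
    (ℓ : ℕ) [Fact ℓ.Prime] (ι : PadicAlgCl ℓ ≃+* ℂ)
    (ρ : Literature.NumberTheory.GaloisRepresentations.FramedGaloisRep F (PadicAlgCl ℓ) (m * n)),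
    ρ.toGaloisRep.IsIrreducible →
    (∀ (v : IsDedekindDomain.HeightOneSpectrum (NumberField.RingOfIntegers F))
      (hv : ((ℓ : ℕ) : NumberField.RingOfIntegers F) ∈ v.asIdeal),
      (Literature.NumberTheory.PAdicHodge.fontainePstAdicCompletion v ℓ hv).IsDeRhamFramed (ρ.toLocal v)) →
    (∀ᶠ v : IsDedekindDomain.HeightOneSpectrum (NumberField.RingOfIntegers F) in Filter.cofinite,
      ∃ α β : Multiset ℂ, π₁.1.HasSatakeParamAt v α ∧ π₂.1.HasSatakeParamAt v β ∧ ρ.IsUnramifiedAt v ∧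
        ρ.HasFrobCharpolyAt v
          (Literature.NumberTheory.Automorphic.arithFrobPolyOfSatake ι v.residueCard 1
            (Literature.NumberTheory.Automorphic.satakeTensor α β))) →
    ∀ hcpt : Literature.NumberTheory.Automorphic.isCompact_glFiniteIntegralLevel (m * n) F,
      ∃ P : Literature.NumberTheory.Automorphic.AutomorphicRepData
          (Literature.NumberTheory.Automorphic.AutomorphyDatum.gl (m * n) F hcpt),
        ∀ᶠ v : IsDedekindDomain.HeightOneSpectrum (NumberField.RingOfIntegers F) in Filter.cofinite,
          Summit.Langlands.SatakeFrobCompatibleAt ι P ρ v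

/-- **THE RUNG** (the filed statement): the family at `(m, n) = (3, 3)` — clause (B) for irreducible de Rham
`GL₉`-representations of `GL₃ ⊠ GL₃` type over every number field. -/
def RankinSelbergGL3GL3 : Prop := RankinSelbergGaloisToAutomorphic 3 3

/-- The floor cell `(2,2)` of the family as a decl (decided modulo the in-tree named fact, `floor_two_two`). -/
def RankinSelbergGL2GL2 : Prop := RankinSelbergGaloisToAutomorphic 2 2

/-- The floor cell `(2,3)` of the family as a decl (decided modulo Kim–Shahidi Thm A, `floor_two_three`). -/
def RankinSelbergGL2GL3 : Prop := RankinSelbergGaloisToAutomorphic 2 3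

/-! ## 5. On-path: the summit gives every cell `m, n ≥ 1` -/

/-- **Dial monotonicity in the summit direction**: `Langlands → RankinSelbergGaloisToAutomorphic m n` for every
`m, n ≥ 1` — clause (B) at rank `mn` over `F` for the reciprocity datum the summit provides. -/
theorem rankinSelbergGaloisToAutomorphic_of_langlands (m n : ℕ) (hm : 1 ≤ m) (hn : 1 ≤ n)
    (hL : _root_.Langlands) : RankinSelbergGaloisToAutomorphic m n := by
  intro F _ _ hmF hnF π₁ π₂ ℓ _ ι ρ hirr hdR hsec hcpt
  obtain ⟨⟨Rec⟩, hall⟩ := hL F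
  have hpos : 0 < m * n := Nat.mul_pos hm hn
  have hB : GaloisToAutomorphic (m * n) Rec hcpt := (hall Rec (m * n) hpos hcpt).2
  have hgeo : IsGeometricFramed Rec ρ :=
    ⟨hsec.mono fun v ⟨_, _, _, _, hur, _⟩ => hur, fun v hv => hdR v hv⟩
  obtain ⟨π', -, hcorr⟩ := hB ℓ ι ρ hirr hgeo
  exact ⟨π'.1, hcorr.1⟩

/-- **F4 on-path lemma for the rung**: `Langlands → RankinSelbergGL3GL3`. -/
@[aesop safe apply]
theorem RankinSelbergGL3GL3_of_Langlands (hL : _root_.Langlands) : RankinSelbergGL3GL3 :=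
  rankinSelbergGaloisToAutomorphic_of_langlands 3 3 (by norm_num) (by norm_num) hL


end Summit.Langlands.Langlands.Cruxes.ReciprocityUpToIrreducibility.RankinSelbergGL3GL3

end
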